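import Summits.CriticalPhenomena.Ising3DConformalLimit.Theorems.ExistsScaleCovariantLimit.Negative.DyadicIdentity
import HarnessLib

/-!
# Dyadic convergence to a scale-covariant limit is convergence along the full filter
(line `Sketch` of the crux `ExistsScaleCovariantLimit`, item stmt-CriticalPhenomena-1981;
stub `stub_pinnedLimitOfDyadic`, engine §I)

The pinned zoom of the critical `ℤ³` Ising correlators,
`pz n δ x := rescaledCorrelator (criticalCorr 3) rhoPin n δ x = ρ_pin(δ)ⁿ ⟨∏ σ_{⌊xᵢ/δ⌋}⟩_{β_c}`,
`ρ_pin(δ) = ⟨σ₀ σ_{⌊1/δ⌋e₀}⟩^{-1/2}`, is an exact orbit of the dilation group: for `s, δ > 0`,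
`pz n (δ/s) x = pz₂(δ)(0, s e₀)^{-n/2} · pz n δ (s·x)` (`Dyadic.pz_scale`). If the zoom converges along
the DYADIC meshes `2^{-k}` (all `n`, locally uniformly off the diagonals) to `S`, and `S` is scale
covariant off the diagonals with exponent `Δ`, then the zoom converges to `S` along the FULL filter
`δ → 0⁺`, i.e. `HasPointwiseScalingLimit (criticalCorr 3) rhoPin S`.

Mechanism: every mesh is `δ = s⁻¹2^{-k}` with `s ∈ [1,2)` and `k → ∞` (`dyadic_decomposition`); the
two dyadic inputs — uniform convergence of `pz n (2^{-k})` on the compact set of dilates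
`{s·x : s ∈ [1,2], x ∈ K}` and of `pz₂(2^{-k})` on the axis arc `{(0, s e₀) : s ∈ [1,2]}` — control
the right-hand side of the re-pinning identity uniformly; scale covariance (`S₂(0,se₀) = s^{-2Δ}`,
`two_cfg0_eq`, from the exact pinning `S₂(0,e₀) = 1` which passes to the limit) makes the limit
`s^{nΔ} S n (s·x) = S n x` independent of `s`; Heine–Cantor for `t ↦ t^{-n/2}` on `[m/2, 1]`,
`m = 2^{-2Δ}` (`Δ ≥ 0` by Messager–Miracle-Solé monotonicity along the axis, `pz_two_cfg0_le_one`).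

Ported from the standing disprover's `Disproof.lean` §I (`Dyadic.pinnedLimit_of_dyadic`, cdisprove
cycle 2), with the abbreviations `dyad`, `cfg0`, `pz` expanded; every auxiliary lemma is the landed
one of `Theorems/ExistsScaleCovariantLimit/Negative/DyadicIdentity.lean`. No named facts. [folklore]
-/

noncomputable section
namespace Summit.CriticalPhenomena.Ising3DConformalLimit.Cruxes.ExistsScaleCovariantLimit.TwoHierarchies
open Literature.Probability.LatticeModels Filter Set
open scoped Topology
open Summit.CriticalPhenomena.Ising3DConformalLimit.MoebiusLimitExistsOnlyInteraction (rhoPin)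

open Summit.CriticalPhenomena.Ising3DConformalLimit.ExistsScaleCovariantLimitNegative.Dyadic
open Summit.CriticalPhenomena.Ising3DConformalLimit.PinnedClusterPoints (cfg01_mem rescaled_pin_cfg01)
open Summit.CriticalPhenomena.Ising3DConformalLimit.OnlyInteractionTightness
  (abs_rescaledCorrelator_le)

local notation3 (prettyPrint := false) "cfg0[" s "]" =>
  (![0, EuclideanSpace.single 0 s] : Fin 2 → EuclideanSpace ℝ (Fin 3))
local notation3 (prettyPrint := false) "pz" => rescaledCorrelator (criticalCorr 3) rhoPin

/-- **Engine §I — dyadic convergence to a scale-covariant limit ⟹ the pinned zoom converges along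
the FULL filter** (to the same limit). The two dyadic inputs — uniform convergence of `pz n (2^{-k})`
on the compact set of dilates `{s·x : s ∈ [1,2], x ∈ K}` and of `pz 2 (2^{-k})` on the axis arc
`{(0, s e₀) : s ∈ [1,2]}` — control
`pz n (s⁻¹2^{-k}) x = pz₂(2^{-k})(0,se₀)^{-n/2} · pz n (2^{-k})(s·x)` uniformly; scale covariance makes
the limit `s^{nΔ} S n (s·x) = S n x` independent of `s` (ported from the standing disprover's
`Dyadic.pinnedLimit_of_dyadic`). [folklore] -/
theorem stub_pinnedLimitOfDyadic : ∀ (S : CorrFamily 3) (Δ : ℝ), (∀ n : ℕ, TendstoLocallyUniformlyOn (fun k : ℕ => rescaledCorrelator (criticalCorr 3) rhoPin n (((2:ℝ) ^ k)⁻¹)) (S n) atTop (NonCoincident 3 n)) → (∀ (n : ℕ) (c : ℝ), 0 < c → ∀ x ∈ NonCoincident 3 n, S n (fun i => c • x i) = c ^ (-(n:ℝ) * Δ) * S n x) → HasPointwiseScalingLimit (criticalCorr 3) rhoPin S := by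
  intro S Δ hdy hsc
  -- the value `S₂(0,e₀) = 1`, the axis law, `Δ ≥ 0`
  have h1 : S 2 cfg0[(1:ℝ)] = 1 := by
    have h := (hdy 2).tendsto_at cfg01_mem
    have h' : Tendsto (fun _ : ℕ => (1:ℝ)) atTop (𝓝 (S 2 cfg0[(1:ℝ)])) :=
      h.congr fun k => rescaled_pin_cfg01 (((2:ℝ) ^ k)⁻¹)
    exact (tendsto_nhds_unique tendsto_const_nhds h').symm
  have hax : ∀ s : ℝ, 0 < s → S 2 cfg0[s] = s ^ (-(2:ℝ) * Δ) := fun s hs => two_cfg0_eq h1 hsc hs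
  have hΔ : 0 ≤ Δ := by
    by_contra hneg
    push Not at hneg
    have hle : S 2 cfg0[(2:ℝ)] ≤ 1 :=
      le_of_tendsto ((hdy 2).tendsto_at (cfg0_mem (s := 2) two_ne_zero))
        (Filter.Eventually.of_forall fun k => pz_two_cfg0_le_one (dyad_pos k) one_le_two)
    rw [hax 2 two_pos] at hle
    have : (1:ℝ) < (2:ℝ) ^ (-(2:ℝ) * Δ) := Real.one_lt_rpow one_lt_two (by nlinarith)
    linarith
  -- the lower bound `m` of the pinned pair ratio on the window
  have hm0 : 0 < (2:ℝ) ^ (-(2:ℝ) * Δ) := Real.rpow_pos_of_pos two_pos _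
  set m : ℝ := (2:ℝ) ^ (-(2:ℝ) * Δ) with hm
  have hev_m : ∀ᶠ k in atTop, m / 2 < pz 2 (((2:ℝ) ^ k)⁻¹) cfg0[(2:ℝ)] := by
    have h := (hdy 2).tendsto_at (cfg0_mem (s := 2) two_ne_zero)
    rw [hax 2 two_pos] at h
    exact h.eventually_const_lt (by linarith)
  intro n
  rw [tendstoLocallyUniformlyOn_iff_forall_isCompact (isOpen_nonCoincident 3 n)]
  intro K hKs hKc
  rw [Metric.tendstoUniformlyOn_iff]
  intro ε hε
  -- compact set of dilates
  have hgc : Continuous (fun p : ℝ × (Fin n → EuclideanSpace ℝ (Fin 3)) => fun i => p.1 • p.2 i) :=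
    continuous_pi fun i => continuous_fst.smul ((continuous_apply i).comp continuous_snd)
  set C : Set (Fin n → EuclideanSpace ℝ (Fin 3)) :=
    (fun p : ℝ × (Fin n → EuclideanSpace ℝ (Fin 3)) => fun i => p.1 • p.2 i) '' (Set.Icc (1:ℝ) 2 ×ˢ K)
    with hC
  have hCc : IsCompact C := (isCompact_Icc.prod hKc).image hgc
  have hCs : C ⊆ NonCoincident 3 n := by
    rintro _ ⟨⟨s, x⟩, ⟨hs, hx⟩, rfl⟩
    exact smul_mem_nonCoincident (by linarith [hs.1] : s ≠ 0) (hKs hx)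
  have hUC := (tendstoLocallyUniformlyOn_iff_forall_isCompact (isOpen_nonCoincident 3 n)).1
    (hdy n) C hCs hCc
  -- compact axis arc
  set A : Set (Fin 2 → EuclideanSpace ℝ (Fin 3)) :=
    (fun s : ℝ => (fun i => s • cfg0[(1:ℝ)] i)) '' Set.Icc (1:ℝ) 2 with hA
  have hAc : IsCompact A :=
    isCompact_Icc.image (continuous_pi fun i => continuous_id.smul continuous_const)
  have hAs : A ⊆ NonCoincident 3 2 := by
    rintro _ ⟨s, hs, rfl⟩
    show (fun i => s • cfg0[(1:ℝ)] i) ∈ NonCoincident 3 2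
    rw [smul_cfg01]
    exact cfg0_mem (by linarith [hs.1])
  have hUA := (tendstoLocallyUniformlyOn_iff_forall_isCompact (isOpen_nonCoincident 3 2)).1
    (hdy 2) A hAs hAc
  -- a bound `M` for `|S n|` on `C`
  obtain ⟨k₂, hk₂⟩ := ((Metric.tendstoUniformlyOn_iff.1 hUC) 1 one_pos).exists_forall_of_atTop
  set M : ℝ := |rhoPin (((2:ℝ) ^ k₂)⁻¹)| ^ n + 1 with hM
  have hM0 : 0 < M := by positivity
  have hSM : ∀ y ∈ C, |S n y| ≤ M := by
    intro y hy
    have h := hk₂ k₂ le_rfl y hy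
    rw [Real.dist_eq] at h
    have h2 : |pz n (((2:ℝ) ^ k₂)⁻¹) y| ≤ |rhoPin (((2:ℝ) ^ k₂)⁻¹)| ^ n :=
      abs_rescaledCorrelator_le rhoPin n (((2:ℝ) ^ k₂)⁻¹) y
    have h3 : |S n y| - |pz n (((2:ℝ) ^ k₂)⁻¹) y| ≤ |S n y - pz n (((2:ℝ) ^ k₂)⁻¹) y| :=
      abs_sub_abs_le_abs_sub (S n y) (pz n (((2:ℝ) ^ k₂)⁻¹) y)
    have h' : |S n y - pz n (((2:ℝ) ^ k₂)⁻¹) y| < 1 := h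
    show |S n y| ≤ |rhoPin (((2:ℝ) ^ k₂)⁻¹)| ^ n + 1
    linarith
  -- the re-pinning function `φ(t) = t^{-n/2}` on `[m/2, 1]`: bounded by `L`, uniformly continuous
  set φ : ℝ → ℝ := fun t => t ^ (-(n:ℝ) / 2) with hφ
  have hexp : -(n:ℝ) / 2 ≤ 0 := by
    have : (0:ℝ) ≤ n := n.cast_nonneg
    linarith
  set L : ℝ := (m / 2) ^ (-(n:ℝ) / 2) with hL
  have hL0 : 0 < L := Real.rpow_pos_of_pos (by linarith) _
  have hφL : ∀ t, m / 2 ≤ t → φ t ≤ L := fun t ht =>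
    Real.rpow_le_rpow_of_nonpos (by linarith) ht hexp
  have hφ0 : ∀ t, 0 < t → 0 < φ t := fun t ht => Real.rpow_pos_of_pos ht _
  have hφc : UniformContinuousOn φ (Set.Icc (m / 2) 1) := by
    refine isCompact_Icc.uniformContinuousOn_of_continuous (fun t ht => ?_)
    exact (Real.continuousAt_rpow_const _ _ (Or.inl (by linarith [ht.1] : t ≠ 0))).continuousWithinAt
  have hεM : 0 < ε / (2 * (M + 1)) := by positivity
  obtain ⟨η, hη, hηφ⟩ := (Metric.uniformContinuousOn_iff.1 hφc) (ε / (2 * (M + 1))) hεM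
  -- thresholds
  have hεL : 0 < ε / (2 * L) := by positivity
  obtain ⟨k₃, hk₃⟩ := ((Metric.tendstoUniformlyOn_iff.1 hUC) (ε / (2 * L)) hεL).exists_forall_of_atTop
  have hηm : 0 < min η (m / 2) := lt_min hη (by linarith)
  obtain ⟨k₄, hk₄⟩ :=
    ((Metric.tendstoUniformlyOn_iff.1 hUA) (min η (m / 2)) hηm).exists_forall_of_atTop
  obtain ⟨k₁, hk₁⟩ := hev_m.exists_forall_of_atTop
  set K₀ : ℕ := max (max k₁ k₂) (max k₃ k₄) with hK₀
  -- conclude along the full filter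
  have hmin : 0 < min (((2:ℝ) ^ K₀)⁻¹) 1 := lt_min (dyad_pos K₀) one_pos
  filter_upwards [Ioo_mem_nhdsGT hmin] with δ hδ x hx
  have hδ0 : 0 < δ := hδ.1
  have hδ1 : δ < 1 := hδ.2.trans_le (min_le_right _ _)
  have hδK : δ < ((2:ℝ) ^ K₀)⁻¹ := hδ.2.trans_le (min_le_left _ _)
  obtain ⟨k, s, hkK, hs1, hs2, rfl⟩ := dyadic_decomposition hδ0 hδ1 K₀ hδK
  have hs0 : 0 < s := by linarith
  have hk1 : k₁ ≤ k := le_trans ((le_max_left _ _).trans (le_max_left _ _)) hkK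
  have hk2' : k₂ ≤ k := le_trans ((le_max_right _ _).trans (le_max_left _ _)) hkK
  have hk3' : k₃ ≤ k := le_trans ((le_max_left _ _).trans (le_max_right _ _)) hkK
  have hk4' : k₄ ≤ k := le_trans ((le_max_right _ _).trans (le_max_right _ _)) hkK
  -- the dilated configuration and the two bases `a` (lattice) and `b` (limit)
  have hyC : (fun i => s • x i) ∈ C := ⟨⟨s, x⟩, ⟨⟨hs1, hs2.le⟩, hx⟩, rfl⟩
  have hsA : cfg0[s] ∈ A := ⟨s, ⟨hs1, hs2.le⟩, smul_cfg01 s⟩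
  have ha_lo : m / 2 ≤ pz 2 (((2:ℝ) ^ k)⁻¹) cfg0[s] :=
    ((hk₁ k hk1).le).trans (pz_two_cfg0_anti (dyad_pos k) hs0.le hs2.le)
  have ha_hi : pz 2 (((2:ℝ) ^ k)⁻¹) cfg0[s] ≤ 1 := pz_two_cfg0_le_one (dyad_pos k) hs1
  have hab : |S 2 cfg0[s] - pz 2 (((2:ℝ) ^ k)⁻¹) cfg0[s]| < min η (m / 2) := by
    have := hk₄ k hk4' _ hsA
    rwa [Real.dist_eq] at this
  have hb_lo : m / 2 ≤ S 2 cfg0[s] := by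
    rw [hax s hs0]
    have : m ≤ s ^ (-(2:ℝ) * Δ) := by
      rw [hm]
      exact Real.rpow_le_rpow_of_nonpos hs0 hs2.le (by nlinarith)
    linarith
  have hb_hi : S 2 cfg0[s] ≤ 1 := by
    rw [hax s hs0]
    exact Real.rpow_le_one_of_one_le_of_nonpos hs1 (by nlinarith)
  -- the scale identity and the covariance of the limit
  have hid : pz n (s⁻¹ * ((2:ℝ) ^ k)⁻¹) x =
      φ (pz 2 (((2:ℝ) ^ k)⁻¹) cfg0[s]) * pz n (((2:ℝ) ^ k)⁻¹) (fun i => s • x i) :=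
    pz_scale hs0 (dyad_pos k) n x
  have hcov : S n x = φ (S 2 cfg0[s]) * S n (fun i => s • x i) := by
    have e := hsc n s hs0 x (hKs hx)
    have hφb : φ (S 2 cfg0[s]) = s ^ ((n:ℝ) * Δ) := by
      show (S 2 cfg0[s]) ^ (-(n:ℝ) / 2) = s ^ ((n:ℝ) * Δ)
      rw [hax s hs0, ← Real.rpow_mul hs0.le]
      congr 1; ring
    have hprod : s ^ ((n:ℝ) * Δ) * s ^ (-(n:ℝ) * Δ) = 1 := by
      rw [← Real.rpow_add hs0]
      have h0 : (n:ℝ) * Δ + -(n:ℝ) * Δ = 0 := by ring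
      rw [h0, Real.rpow_zero]
    rw [hφb, e, ← mul_assoc, hprod, one_mul]
  -- the estimate
  show dist (S n x) (pz n (s⁻¹ * ((2:ℝ) ^ k)⁻¹) x) < ε
  rw [Real.dist_eq, hid, hcov]
  set a : ℝ := pz 2 (((2:ℝ) ^ k)⁻¹) cfg0[s] with ha
  set b : ℝ := S 2 cfg0[s] with hb
  set P : ℝ := pz n (((2:ℝ) ^ k)⁻¹) (fun i => s • x i) with hP
  set Q : ℝ := S n (fun i => s • x i) with hQ
  have hPQ : |Q - P| < ε / (2 * L) := by
    have := hk₃ k hk3' _ hyC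
    rwa [Real.dist_eq] at this
  have hPM : |P| ≤ M + 1 := by
    have h := hk₂ k hk2' _ hyC
    rw [Real.dist_eq] at h
    have h' : |Q - P| < 1 := h
    have := abs_sub_abs_le_abs_sub P Q
    rw [abs_sub_comm] at this
    linarith [hSM _ hyC]
  have hφab : |φ a - φ b| < ε / (2 * (M + 1)) := by
    have h := hηφ a ⟨ha_lo, ha_hi⟩ b ⟨hb_lo, hb_hi⟩ (by
      rw [Real.dist_eq, abs_sub_comm]; exact hab.trans_le (min_le_left _ _))
    rwa [Real.dist_eq] at h
  have hφbL : |φ b| ≤ L := by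
    rw [abs_of_pos (hφ0 b (by linarith))]
    exact hφL b hb_lo
  have t1 : |φ b - φ a| * |P| ≤ ε / (2 * (M + 1)) * (M + 1) := by
    rw [abs_sub_comm]
    exact mul_le_mul hφab.le hPM (abs_nonneg _) hεM.le
  have t2 : |φ b| * |Q - P| ≤ L * |Q - P| := mul_le_mul_of_nonneg_right hφbL (abs_nonneg _)
  have t3 : L * |Q - P| < L * (ε / (2 * L)) := mul_lt_mul_of_pos_left hPQ hL0
  have e1 : ε / (2 * (M + 1)) * (M + 1) = ε / 2 := by field_simp
  have e2 : L * (ε / (2 * L)) = ε / 2 := by field_simp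
  calc |φ b * Q - φ a * P|
      = |(φ b - φ a) * P + φ b * (Q - P)| := by ring_nf
    _ ≤ |φ b - φ a| * |P| + |φ b| * |Q - P| := by
        refine (abs_add_le _ _).trans ?_
        rw [abs_mul, abs_mul]
    _ < ε / 2 + ε / 2 := by linarith
    _ = ε := by ring

end Summit.CriticalPhenomena.Ising3DConformalLimit.Cruxes.ExistsScaleCovariantLimit.TwoHierarchies

end
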